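import Summits.CriticalPhenomena.PercolationContinuityZ3.Theorems.PercNearOneGluingNoHeavyLowerTailSahiTransportRho

/-!
# `NoHeavyLowerTail` (crux stmt-CriticalPhenomena-4575), Sahi / Kahn positivity: TRANSPORT CERTIFICATES (IV) —
# SEPARABLE certificates: a gradient⊗gradient decomposition of the bilinear remainder replaces the transport condition

Support file (cell `prim-l12`, seat P3, gen 6; `--supports stmt-CriticalPhenomena-4575`).  No `sorry`, no named facts, standard axioms.
New mathematics (this programme).

`…SahiTransportCert` reduces Kahn's Conjecture 5 / Sahi's `C₃` for a junta first slot `H` (and ALL increasing `U, V`, every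
dimension) to a TRANSPORT CERTIFICATE: a kernel `Π` on the pattern cube with prescribed row sums, bounded column sums, and the
transport condition (TC) = nonnegativity of the bilinear remainder `B_Π(1_𝒳, 1_𝒵)` (`remForm`) on every PAIR of up-sets of
`2^{Fin k}` — `M(k)²` inequalities (`400`, `28 224`, `57.5·10⁶` for `k = 3, 4, 5`).

Here we replace (TC) by a STRONGER but far smaller and purely algebraic condition.  The cone `K` of increasing nonnegative pattern
functions is dual to the cone spanned by the `1 + k·2^{k-1}` functionals
  `f ↦ f(∅)`  and  `f ↦ f(S ∪ {i}) − f(S)`   (`genPair`),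
so `B_Π` is nonnegative on `K × K` as soon as its matrix is a nonnegative combination of tensor products of these functionals:
  (SEP)  `B_Π(δ_U, δ_V) = Σ_{a,b} Λ(a,b) · g_a(U) · g_b(V)`,  `Λ ≥ 0`
(`4^k` linear identities; `SepCert`).  We prove `B_Π` is bilinear (`remForm_eq_sum_sum`), hence (SEP) gives
`B_Π(f,g) = Σ Λ(a,b)·g_a(f)·g_b(g) ≥ 0` for increasing nonnegative `f, g` (`remForm_nonneg_of_sepCert`), hence a transport certificate
(`transportCert_of_sepCert`) and `E₃(1_H,1_U,1_V) ≥ 0` (`sahiE_three_nonneg_of_sepCert`); `sepEntry` / `remForm_dlt_dlt` give the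
matrix of `B_Π` in closed form, the shape in which a concrete certificate is checked (`sepCert_of_entries`).
For `H_k = 2^{Fin k}` (SEP) is the martingale-difference representation of the covariance of a product measure.  Status (seat census,
exact rational LP; kit j108917, j109006 and local): separable certificates exist for all `18` nontrivial up-sets of `2^3` at every
parameter vector tried (`12`, incl. `(1/50, 49/50, 1/50)` and `(19/20)^3`), for all `166` of `2^4` at `7` of `8` vectors and for all
`208` orbit types of `2^5` at `5` vectors (float LP); but NOT universally: for `K_{2,2} = (a ∨ b) ∧ (c ∨ d)` at uniform density `t`
the separable LP is (exactly) infeasible for `t ≥ 3/4` while the transport-certificate LP is feasible — separability is strictly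
stronger than (TC) on this programme's own certificates (the monotone cone is not simplicial), and the obstruction sits exactly on
the product of two non-principal events.  So (SEP) is a cheap SUFFICIENT condition (a `2^k × 2^k` matrix identity instead of `M(k)²`
inequalities) covering most pattern events, not a replacement of the transport-certificate conjecture. [this work]
-/

noncomputable section

open scoped Classical

namespace Summit.CriticalPhenomena.PercolationContinuityZ3.Theorems

namespace SahiTransportCert

open Finset
open SahiHittingSlot
open Literature.Combinatorics.Sahi2008
open Literature.Probability.Percolation (DeterminedBy)
open Literature.Probability.Percolation.DecisionTree (ind ind_of_mem ind_of_not_mem ind_nonneg)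

variable {ι : Type} [Fintype ι] {k : ℕ}

/-! ### The dual generators of the monotone cone -/

/-- The generators of the dual of the cone of increasing nonnegative pattern functions, applied to `f`:
`none ↦ f(∅)`, `some (S, i) ↦ f(S ∪ {i}) − f(S)`. [this work] -/
def genPair (a : Option (Set (Fin k) × Fin k)) (f : Set (Fin k) → ℝ) : ℝ :=
  match a with
  | none => f ∅
  | some (S, i) => f (insert i S) - f S

/-- The generators are nonnegative on increasing nonnegative functions. [this work] -/
theorem genPair_nonneg {f : Set (Fin k) → ℝ} (hf : Monotone f) (hf0 : ∀ S, 0 ≤ f S) (a : Option (Set (Fin k) × Fin k)) :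
    0 ≤ genPair a f := by
  rcases a with _ | ⟨S, i⟩
  · exact hf0 ∅
  · show 0 ≤ f (insert i S) - f S
    exact sub_nonneg.2 (hf (Set.subset_insert i S))

/-- The point mass pattern function `δ_U`. [this work] -/
def dlt (U : Set (Fin k)) : Set (Fin k) → ℝ := fun S => if S = U then 1 else 0

/-- Every pattern function is the combination of point masses with its own values. [this work] -/
theorem sum_mul_dlt (f : Set (Fin k) → ℝ) (S : Set (Fin k)) : ∑ U, f U * dlt U S = f S := by
  have h : ∀ U, f U * dlt U S = if S = U then f U else 0 := fun U => by
    unfold dlt; split_ifs <;> simp_all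
  simp_rw [h]
  rw [Finset.sum_ite_eq]; simp

/-- A generator applied to `f` is the `f`-combination of its values on point masses. [this work] -/
theorem genPair_eq_sum (a : Option (Set (Fin k) × Fin k)) (f : Set (Fin k) → ℝ) :
    genPair a f = ∑ U, f U * genPair a (dlt U) := by
  rcases a with _ | ⟨S, i⟩
  · show f ∅ = ∑ U, f U * dlt U ∅
    rw [sum_mul_dlt]
  · show f (insert i S) - f S = ∑ U, f U * (dlt U (insert i S) - dlt U S)
    simp only [mul_sub, sum_sub_distrib, sum_mul_dlt]

/-! ### Bilinearity of the remainder -/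

/-- `B_Π` is additive-homogeneous in the second slot. [this work] -/
theorem remForm_add_smul_right (q : Fin k → unitInterval) (Hk : Set (Set (Fin k))) (Kr : Set (Fin k) → Set (Fin k) → ℝ)
    (f g g' : Set (Fin k) → ℝ) (a : ℝ) :
    remForm q Hk Kr f (g + a • g') = remForm q Hk Kr f g + a * remForm q Hk Kr f g' := by
  rw [remForm_comm, remForm_add_smul_left, remForm_comm q Hk Kr g f, remForm_comm q Hk Kr g' f]

/-- `B_Π(0, g) = 0`. [this work] -/
theorem remForm_zero_left (q : Fin k → unitInterval) (Hk : Set (Set (Fin k))) (Kr : Set (Fin k) → Set (Fin k) → ℝ)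
    (g : Set (Fin k) → ℝ) : remForm q Hk Kr 0 g = 0 := by
  have h := remForm_add_smul_left q Hk Kr 0 0 g 1
  simp only [smul_zero, add_zero, one_mul] at h
  linarith

/-- `B_Π` of a finite combination in the first slot. [this work] -/
theorem remForm_sum_smul_left (q : Fin k → unitInterval) (Hk : Set (Set (Fin k))) (Kr : Set (Fin k) → Set (Fin k) → ℝ)
    (s : Finset (Set (Fin k))) (c : Set (Fin k) → ℝ) (F : Set (Fin k) → Set (Fin k) → ℝ) (g : Set (Fin k) → ℝ) :
    remForm q Hk Kr (∑ U ∈ s, c U • F U) g = ∑ U ∈ s, c U * remForm q Hk Kr (F U) g := by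
  induction s using Finset.induction_on with
  | empty => simp [remForm_zero_left]
  | insert U s hU ih =>
    rw [Finset.sum_insert hU, Finset.sum_insert hU, add_comm (c U • F U), remForm_add_smul_left, ih, add_comm]

/-- A pattern function as the combination of point masses. [this work] -/
theorem eq_sum_smul_dlt (f : Set (Fin k) → ℝ) : f = ∑ U, f U • dlt U := by
  funext S
  rw [Finset.sum_apply]
  simp only [Pi.smul_apply, smul_eq_mul]
  exact (sum_mul_dlt f S).symm

/-- **Bilinearity**: `B_Π(f,g) = Σ_U Σ_V f(U) g(V) B_Π(δ_U, δ_V)`. [this work] -/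
theorem remForm_eq_sum_sum (q : Fin k → unitInterval) (Hk : Set (Set (Fin k))) (Kr : Set (Fin k) → Set (Fin k) → ℝ)
    (f g : Set (Fin k) → ℝ) :
    remForm q Hk Kr f g = ∑ U, ∑ V, f U * g V * remForm q Hk Kr (dlt U) (dlt V) := by
  conv_lhs => rw [eq_sum_smul_dlt f]
  rw [remForm_sum_smul_left]
  refine sum_congr rfl fun U _ => ?_
  conv_lhs => rw [eq_sum_smul_dlt g, remForm_comm, remForm_sum_smul_left]
  rw [mul_sum]
  exact sum_congr rfl fun V _ => by rw [remForm_comm]; ring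

/-! ### Separable certificates -/

/-- **A SEPARABLE TRANSPORT CERTIFICATE**: a kernel `Π ≥ 0` on `{S ⊆ T, S ∉ Hk, T ∈ Hk}` with row sums `θ·w(S)` and column sums
`≤ (2−θ)·w(T)`, together with nonnegative multipliers `Λ(a,b)` on pairs of dual generators such that the matrix of the bilinear
remainder decomposes as `B_Π(δ_U, δ_V) = Σ_{a,b} Λ(a,b) g_a(δ_U) g_b(δ_V)` (`4^k` identities).  No transport condition. [this work] -/
def SepCert (q : Fin k → unitInterval) (Hk : Set (Set (Fin k))) (Kr : Set (Fin k) → Set (Fin k) → ℝ)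
    (Λ : Option (Set (Fin k) × Fin k) → Option (Set (Fin k) × Fin k) → ℝ) : Prop :=
  (∀ S T, 0 ≤ Kr S T) ∧ (∀ S T, Kr S T ≠ 0 → S ⊆ T) ∧ (∀ S T, Kr S T ≠ 0 → S ∉ Hk) ∧ (∀ S T, Kr S T ≠ 0 → T ∈ Hk) ∧
  (∀ S, S ∉ Hk → ∑ T, Kr S T = pr q Hk * bernoulliWeight q S) ∧
  (∀ T, ∑ S, Kr S T ≤ (2 - pr q Hk) * bernoulliWeight q T) ∧
  (∀ a b, 0 ≤ Λ a b) ∧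
  (∀ U V : Set (Fin k), remForm q Hk Kr (dlt U) (dlt V) = ∑ a, ∑ b, Λ a b * genPair a (dlt U) * genPair b (dlt V))

/-- Under a separable certificate the remainder is a nonnegative combination of products of generators:
`B_Π(f,g) = Σ_{a,b} Λ(a,b)·g_a(f)·g_b(g)`. [this work] -/
theorem remForm_eq_of_sepCert {q : Fin k → unitInterval} {Hk : Set (Set (Fin k))} {Kr : Set (Fin k) → Set (Fin k) → ℝ}
    {Λ : Option (Set (Fin k) × Fin k) → Option (Set (Fin k) × Fin k) → ℝ} (h : SepCert q Hk Kr Λ) (f g : Set (Fin k) → ℝ) :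
    remForm q Hk Kr f g = ∑ a, ∑ b, Λ a b * genPair a f * genPair b g := by
  rw [remForm_eq_sum_sum]
  have hsep := h.2.2.2.2.2.2.2
  set T : Set (Fin k) → Set (Fin k) → Option (Set (Fin k) × Fin k) → Option (Set (Fin k) × Fin k) → ℝ :=
    fun U V a b => f U * g V * (Λ a b * genPair a (dlt U) * genPair b (dlt V)) with hT
  have hL : ∀ U V, f U * g V * remForm q Hk Kr (dlt U) (dlt V) = ∑ a, ∑ b, T U V a b := by
    intro U V
    rw [hsep U V, Finset.mul_sum univ (fun a => ∑ b, Λ a b * genPair a (dlt U) * genPair b (dlt V)) (f U * g V)]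
    exact sum_congr rfl fun a _ => Finset.mul_sum univ (fun b => Λ a b * genPair a (dlt U) * genPair b (dlt V)) (f U * g V)
  have hR : ∀ a b, Λ a b * genPair a f * genPair b g = ∑ U, ∑ V, T U V a b := by
    intro a b
    rw [genPair_eq_sum a f, genPair_eq_sum b g, mul_assoc, Finset.sum_mul_sum,
      Finset.mul_sum univ (fun U => ∑ V, f U * genPair a (dlt U) * (g V * genPair b (dlt V))) (Λ a b)]
    refine sum_congr rfl fun U _ => ?_
    rw [Finset.mul_sum univ (fun V => f U * genPair a (dlt U) * (g V * genPair b (dlt V))) (Λ a b)]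
    exact sum_congr rfl fun V _ => by simp only [hT]; ring
  rw [sum_congr rfl fun U _ => sum_congr rfl fun V _ => hL U V, sum_congr rfl fun a _ => sum_congr rfl fun b _ => hR a b]
  calc ∑ U, ∑ V, ∑ a, ∑ b, T U V a b = ∑ U, ∑ a, ∑ V, ∑ b, T U V a b := sum_congr rfl fun U _ => Finset.sum_comm
    _ = ∑ a, ∑ U, ∑ V, ∑ b, T U V a b := Finset.sum_comm
    _ = ∑ a, ∑ U, ∑ b, ∑ V, T U V a b := sum_congr rfl fun a _ => sum_congr rfl fun U _ => Finset.sum_comm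
    _ = ∑ a, ∑ b, ∑ U, ∑ V, T U V a b := sum_congr rfl fun a _ => Finset.sum_comm

/-- A separable certificate makes the remainder nonnegative on increasing nonnegative pattern functions — with no appeal to the
cone lemma and no transport condition. [this work] -/
theorem remForm_nonneg_of_sepCert {q : Fin k → unitInterval} {Hk : Set (Set (Fin k))} {Kr : Set (Fin k) → Set (Fin k) → ℝ}
    {Λ : Option (Set (Fin k) × Fin k) → Option (Set (Fin k) × Fin k) → ℝ} (h : SepCert q Hk Kr Λ)
    {f g : Set (Fin k) → ℝ} (hf : Monotone f) (hf0 : ∀ S, 0 ≤ f S) (hg : Monotone g) (hg0 : ∀ S, 0 ≤ g S) :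
    0 ≤ remForm q Hk Kr f g := by
  rw [remForm_eq_of_sepCert h]
  exact sum_nonneg fun a _ => sum_nonneg fun b _ =>
    mul_nonneg (mul_nonneg (h.2.2.2.2.2.2.1 a b) (genPair_nonneg hf hf0 a)) (genPair_nonneg hg hg0 b)

/-- **Separable ⇒ transport certificate.** [this work] -/
theorem transportCert_of_sepCert {q : Fin k → unitInterval} {Hk : Set (Set (Fin k))} {Kr : Set (Fin k) → Set (Fin k) → ℝ}
    {Λ : Option (Set (Fin k) × Fin k) → Option (Set (Fin k) × Fin k) → ℝ} (h : SepCert q Hk Kr Λ) : TransportCert q Hk Kr := by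
  obtain ⟨h0, hsub, hoff, hmem, hrow, hcol, hΛ, hsep⟩ := h
  refine ⟨h0, hsub, hoff, hmem, hrow, hcol, fun 𝒳 𝒵 h𝒳 h𝒵 => ?_⟩
  have hrowH : ∀ S, S ∈ Hk → ∀ T, Kr S T = 0 := fun S hS T => by
    by_contra hne; exact hoff S T hne hS
  have hnn : 0 ≤ remForm q Hk Kr (ind 𝒳) (ind 𝒵) :=
    remForm_nonneg_of_sepCert ⟨h0, hsub, hoff, hmem, hrow, hcol, hΛ, hsep⟩ (monotone_ind_of_isUpperSet h𝒳) (ind_nonneg 𝒳)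
      (monotone_ind_of_isUpperSet h𝒵) (ind_nonneg 𝒵)
  rw [remForm_ind q Hk Kr hrow hrowH] at hnn
  linarith

/-- **KAHN'S CONJECTURE 5 / SAHI'S `C₃` FOR A SEPARABLY CERTIFIED JUNTA SLOT**: `E₃(1_H, 1_U, 1_V) ≥ 0` for the block-determined
increasing `H` and ALL increasing `U, V`, every dimension. [this work] -/
theorem sahiE_three_nonneg_of_sepCert (p : ι → unitInterval) (e : Fin k ↪ ι) {H : Set (Set ι)}
    (hH : DeterminedBy H (Set.range e)) {Kr : Set (Fin k) → Set (Fin k) → ℝ}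
    {Λ : Option (Set (Fin k) × Fin k) → Option (Set (Fin k) × Fin k) → ℝ} (hc : SepCert (pk e p) (pat e H) Kr Λ)
    {U V : Set (Set ι)} (hU : IsUpperSet U) (hV : IsUpperSet V) :
    0 ≤ sahiE (bernoulliWeight p) 3 ![ind H, ind U, ind V] :=
  sahiE_three_nonneg_of_transportCert p e hH (transportCert_of_sepCert hc) hU hV

/-! ### The matrix of the remainder in closed form -/

/-- The matrix entry `B_Π(δ_U, δ_V)` in closed form: with `θ = w(Hk)`, `h = 1_{Hk}`,
diagonal `U = V`: `(2h(U) − θ)·w(U)·(1 − w(U)) − Σ_S Π(S,U) + Σ_T Π(U,T)`; off-diagonal: `(θ − h(U) − h(V))·w(U)·w(V)`.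
This is the entry a concrete certificate is checked against. [this work] -/
def sepEntry (q : Fin k → unitInterval) (Hk : Set (Set (Fin k))) (Kr : Set (Fin k) → Set (Fin k) → ℝ) (U V : Set (Fin k)) : ℝ :=
  if U = V then (2 * ind Hk U - pr q Hk) * bernoulliWeight q U * (1 - bernoulliWeight q U) - ∑ S, Kr S U + ∑ T, Kr U T
  else (pr q Hk - ind Hk U - ind Hk V) * bernoulliWeight q U * bernoulliWeight q V

/-- A weighted sum against a point mass. [this work] -/
theorem sum_mul_dlt' (c : Set (Fin k) → ℝ) (U : Set (Fin k)) : ∑ S, c S * dlt U S = c U := by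
  have h : ∀ S, c S * dlt U S = if U = S then c S else 0 := fun S => by
    unfold dlt; split_ifs <;> simp_all
  simp_rw [h]
  rw [Finset.sum_ite_eq]; simp

/-- The matrix of the remainder is `sepEntry`. [this work] -/
theorem remForm_dlt_dlt (q : Fin k → unitInterval) (Hk : Set (Set (Fin k))) (Kr : Set (Fin k) → Set (Fin k) → ℝ)
    (U V : Set (Fin k)) : remForm q Hk Kr (dlt U) (dlt V) = sepEntry q Hk Kr U V := by
  unfold remForm cubeForm sepEntry
  have e1 : ∑ S, bernoulliWeight q S * dlt U S = bernoulliWeight q U := sum_mul_dlt' _ U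
  have e2 : ∑ S, bernoulliWeight q S * dlt V S = bernoulliWeight q V := sum_mul_dlt' _ V
  have e3 : ∑ S, bernoulliWeight q S * (ind Hk S * dlt U S) = bernoulliWeight q U * ind Hk U := by
    simp_rw [← mul_assoc]; exact sum_mul_dlt' _ U
  have e4 : ∑ S, bernoulliWeight q S * (ind Hk S * dlt V S) = bernoulliWeight q V * ind Hk V := by
    simp_rw [← mul_assoc]; exact sum_mul_dlt' _ V
  by_cases hUV : U = V
  · subst hUV
    have hd : ∀ S, dlt U S * dlt U S = dlt U S := fun S => by unfold dlt; split_ifs <;> simp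
    have e5 : ∑ S, bernoulliWeight q S * (ind Hk S * (dlt U S * dlt U S)) = bernoulliWeight q U * ind Hk U := by
      simp_rw [hd]; exact e3
    have e6 : ∑ S, bernoulliWeight q S * (dlt U S * dlt U S) = bernoulliWeight q U := by simp_rw [hd]; exact e1
    have e7 : ∑ S, ∑ T, Kr S T * (dlt U T * dlt U T - dlt U S * dlt U S) = ∑ S, Kr S U - ∑ T, Kr U T := by
      simp_rw [hd, mul_sub, sum_sub_distrib]
      have a1 : ∀ S, ∑ T, Kr S T * dlt U T = Kr S U := fun S => sum_mul_dlt' _ U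
      have a2 : ∑ S, ∑ T, Kr S T * dlt U S = ∑ T, Kr U T := by
        rw [sum_comm]; exact sum_congr rfl fun T _ => sum_mul_dlt' (fun S => Kr S T) U
      simp_rw [a1]; rw [a2]
    rw [e5, e6, e1, e3, e7, if_pos rfl]
    ring
  · have hd : ∀ S, dlt U S * dlt V S = 0 := fun S => by
      unfold dlt; split_ifs with h1 h2 <;> simp_all
    have e5 : ∑ S, bernoulliWeight q S * (ind Hk S * (dlt U S * dlt V S)) = 0 := by simp [hd]
    have e6 : ∑ S, bernoulliWeight q S * (dlt U S * dlt V S) = 0 := by simp [hd]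
    have e7 : ∑ S, ∑ T, Kr S T * (dlt U T * dlt V T - dlt U S * dlt V S) = 0 := by simp [hd]
    rw [e5, e6, e1, e2, e3, e4, e7, if_neg hUV]
    ring

/-- The separability clause stated on `sepEntry`: the form in which a concrete certificate is verified. [this work] -/
theorem sepCert_of_entries {q : Fin k → unitInterval} {Hk : Set (Set (Fin k))} {Kr : Set (Fin k) → Set (Fin k) → ℝ}
    {Λ : Option (Set (Fin k) × Fin k) → Option (Set (Fin k) × Fin k) → ℝ}
    (h0 : ∀ S T, 0 ≤ Kr S T) (hsub : ∀ S T, Kr S T ≠ 0 → S ⊆ T) (hoff : ∀ S T, Kr S T ≠ 0 → S ∉ Hk)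
    (hmem : ∀ S T, Kr S T ≠ 0 → T ∈ Hk) (hrow : ∀ S, S ∉ Hk → ∑ T, Kr S T = pr q Hk * bernoulliWeight q S)
    (hcol : ∀ T, ∑ S, Kr S T ≤ (2 - pr q Hk) * bernoulliWeight q T) (hΛ : ∀ a b, 0 ≤ Λ a b)
    (hsep : ∀ U V : Set (Fin k), sepEntry q Hk Kr U V = ∑ a, ∑ b, Λ a b * genPair a (dlt U) * genPair b (dlt V)) :
    SepCert q Hk Kr Λ :=
  ⟨h0, hsub, hoff, hmem, hrow, hcol, hΛ, fun U V => by rw [remForm_dlt_dlt]; exact hsep U V⟩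

end SahiTransportCert

end Summit.CriticalPhenomena.PercolationContinuityZ3.Theorems
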